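import Summits.Ventures.CertifiedManyBodySolver.Rows.CorrWindowCertKernelPoly
import Summits.Ventures.CertifiedManyBodySolver.Downfold.PinnedPairTPrimeOfWindowCertificates
import HarnessLib

/-!
# PINNED `t′`-PAIR nodes‴ (density-affine WN / objective-FAMILY editions) FROM TWO RESIDUALS DENOTED BY *ANY* POLYNOMIALS — the STAGED-REPLAY entry
# for the WN pair path (SEMANTIC-residual twin of `TPrimePinnedPair{Family,}RowWN.of_kernelCerts`, p669208)

Venture CertifiedManyBodySolver; cell `hubbard-obs` / D-0154 (1)(C) COVERAGE; seat `hubbard-cov-la214-box-2` (g3). One-writer rulings in force: pair-link CORE + the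
T shape = hubbard-cov-la214-unc-2 (its semantic twin `SquareTTPrimePinnedPairRowT.of_residPolys` is announced on hubbard-obs STATUS 2026-08-28T22:01:31Z); the
identity-from-residual joint = hubbard-obs-p2 (`CARPolyWindow.windowIdentity_of_residPoly`, `Rows/CorrWindowCertKernelPoly.lean`, p669665); the density-affine /
objective-family WN twins = this seat, BY IMPORT (identity level p667540, one-shot kernel level p669208, semantic level HERE).

WHY (hubbard-obs-p2 g22 MEASUREMENT, hubbard-obs STATUS 2026-08-28T21:21:40Z): one `decide +kernel` declaration holds a normal form of at most ≈ 10⁴ monomials, so no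
La214 certificate (CORE class: ≈ 10⁷ pair terms) passes the ONE-SHOT hypothesis `CARPoly.normalize enc Bkey (residTG …) = R` of p669208; the residual has to be
consumed slice by slice on an encoded accumulator (hubbard-obs-p2's (v′) merge chain: `ChainOK`, `evalPoly_chain`), and the END of such a chain is a polynomial
`R_v` with `evalPoly d R_v = termOp d (residTG …_v)` that is NOT syntactically a `normalize`. This file takes exactly that SEMANTIC hypothesis per vertex.

* `TPrimePinnedPairFamilyRowWN.of_residPolys` — p669208's binder list (rational `U ≥ 0`, hoppings `s_A, s_B`, shared letters / dictionaries / origin letters,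
  objective FAMILY `X` with `termOp d TX_v = X s_v`, ONE shared eom word list `EB`, per-vertex cap/cut rows, ABSTRACT Gram term `termOp d TG_v = gramForm Λ_v O_v`
  with `Λ_v ⪰ 0`, moves, charged words, anti-Hermitian parts) with, per vertex, ANY polynomial `R_v` and `hR_v : evalPoly d R_v = termOp d (residTG …_v)` in
  place of the one-shot normal form (no `hd` / `enc` / `Bkey`), ONE rational inequality `β_v ≤ lowerConst R_v + (μ_v 0 + μ_v 1)(n₀/2 − ν_v)` and the filling
  slope `sl_v = (μ_v 0 + μ_v 1)/2` ⟹ `TPrimePinnedPairFamilyRowWN U s_A s_B cap_A cap_B fl_A fl_B β_A κ_A κ_A′ sl_A β_B κ_B κ_B′ sl_B n₀ X` (every filling).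
  Proof = p669208's with `windowIdentity_of_residPoly` (p669665) in place of `windowIdentity_of_residTG`.
* `TPrimePinnedPairRowWN.of_residPolys` — constant-objective shape (`TPrimePinnedPairRowWN_iff_family`): every NdNiO₂ `…pairs_ABC_P` pair, La214 M2(c) `Po`.
* `…of_residPolys_tb` ×2 — the TWO-LEVEL (symmetry-adapted, thin-integer) Gram instances `TG_v := gramTB K_v blocks_v` (PSD by construction: `gramTBCoef_posSemidef`,
  `termOp_gramTB_eq_gramForm`), i.e. the Gram shape hubbard-obs-p2's (v′) chain is sliced over (`flatten_gramTBslices`) — the END of a chain lands here verbatim.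
* `TPrimePinnedPairRowWN.of_kernelCerts` — the one-shot ABSTRACT-Gram instance for the constant shape (`R_v := normalize enc Bkey (residTG …_v)`, via
  `evalPoly_normalize'`), the edition hubbard-cov-ndnio2-unc-1 named (hubbard-obs STATUS 2026-08-28T22:01:23Z); the family one-shot edition is p669208's.

CONSEQUENCE: the WN pair path accepts the decoded end of a staged kernel replay (or any staging discipline proving `hR_v`) — `lowerConst R_v` is a valid price for
ANY polynomial denoting the residual (an uncollected `R_v` only weakens the bound, never the soundness). NOT addressed: SU(2)-Ward rows (no `[S^±, ·]` slot; the
Ward-free u′ presentation of the certificates is the adopted exit, hubbard-obs STATUS 2026-08-28T20:33:11Z).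
HONEST FRAMING: Lean plumbing; evaluates NO certificate (no `EB`, `TG`, `R` of record is instantiated here), discharges NO node; no number of record, tier, hold,
registry row or box word changes; CONTROL / CALIBRATION class (wording (xx1)); a ceiling never speaks to the presence or absence of superconductivity; no `T_c` / phase
sentence; no item, rung leaf or summit statement is proved here. Zero compute.

References: J. Wang et al., PRX 14 (2024) 031006, §III [cite: WangEtAl2024, §III]; C. Jansson, D. Chaykin, C. Keil, SIAM J. Numer. Anal. 46 (2008) 180, §3
[cite: JanssonChaykinKeil2008, §3]; X. Han, arXiv:2006.06002, §2 [cite: Han2020Bootstrap, §2]; S. Boyd, L. Vandenberghe, *Convex Optimization* (2004) §5.9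
[cite: BoydVandenberghe2004, §5.9].
-/

noncomputable section

namespace Summit.Ventures.CertifiedManyBodySolver.Downfold

open Literature.MathematicalPhysics.QuantumLattice
open Matrix HubbardWave0 Literature.Probability.LatticeModels ThermodynamicLimit Filter Topology
open Literature.MathematicalPhysics.QuantumManyBody.StateRelaxation
open Summit.Ventures.CertifiedQuantumChemistry Summit.Ventures.CertifiedQuantumChemistry.CARPoly
open Summit.Ventures.CertifiedManyBodySolver.CARPolyWindow
open scoped BigOperators ComplexOrder

/-! ## §1 The semantic-residual pair theorems (abstract Gram slot) -/

section ResidPolyPair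

variable {α β : Type*}

/-- **WN-FAMILY PAIR NODE‴ FROM TWO RESIDUALS DENOTED BY ANY POLYNOMIALS** (objective family, every filling, abstract Gram slots, ONE shared `EB`): per vertex
`hR_v : evalPoly d R_v = termOp d (residTG …_v)` and `β_v ≤ lowerConst R_v + (μ_v 0 + μ_v 1)(n₀/2 − ν_v)`, `sl_v = (μ_v 0 + μ_v 1)/2` ⟹
`TPrimePinnedPairFamilyRowWN U s_A s_B cap_A cap_B fl_A fl_B β_A κ_A κ_A′ sl_A β_B κ_B κ_B′ sl_B n₀ X`. [cite: WangEtAl2024, §III] [cite: JanssonChaykinKeil2008, §3] -/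
theorem TPrimePinnedPairFamilyRowWN.of_residPolys
    (U : ℚ) (hU : 0 ≤ U) (n₀ sA sB : ℚ)
    {Λ : Finset (Site 2)} (hΛ : Λ ⊆ Literature.Probability.LatticeModels.box 2 7) (h8 : thicken Λ 1 ⊆ Literature.Probability.LatticeModels.box 2 7)
    (h0 : thicken ({0} : Finset (Site 2)) 1 ⊆ Literature.Probability.LatticeModels.box 2 7) (hz : (0 : Site 2) ∈ Literature.Probability.LatticeModels.box 2 7)
    -- letters (shared)
    (d : α → Orb (PolySite (Literature.Probability.LatticeModels.box 2 7)))
    (dΛ : β → Orb (PolySite Λ)) (f : β → α) (hf : ∀ b, d (f b) = Orb.embMap (PolySite.incl hΛ) (dΛ b))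
    (sp : α → Fin 2) (hsp : ∀ a, (ofLex (d a)).2 = sp a)
    (o : Fin 2 → α) (ho : ∀ σ, d (o σ) = orb (PolySite.pt 0 hz) σ)
    -- the objective family and the SHARED eom words
    (X : ℝ → FermionOp (Literature.Probability.LatticeModels.box 2 7)) (EB : List (Terms β))
    -- vertex A
    (THA : Terms α) (hHA : termOp d THA = (hubbardTTPrimeFermionInteraction 1 (sA : ℝ) (U : ℝ)).localHamiltonian (Literature.Probability.LatticeModels.box 2 7))
    (TEA : Terms α)
    (hEA : termOp d TEA = fermionEmbed (PolySite.incl h0) ((hubbardTTPrimeFermionInteraction 1 (sA : ℝ) (U : ℝ)).meanEnergyObs 1))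
    (TXA : Terms α) (hXA : termOp d TXA = X (sA : ℝ)) (μA : Fin 2 → ℚ) (νA κA capA κA' flA : ℚ)
    (TGA : Terms α) {mA : Type*} [Fintype mA] [DecidableEq mA] {ΛmA : Matrix mA mA ℂ} (hΛmA : ΛmA.PosSemidef)
    (OA : mA → FermionOp (Literature.Probability.LatticeModels.box 2 7)) (hGA : termOp d TGA = gramForm ΛmA OA)
    {nSA : ℕ} (γA : Fin nSA → DihedralGroup 4) (wvA : Fin nSA → Site 2) (hshA : ∀ l, d4ShiftSet (γA l) (wvA l) Λ ⊆ Literature.Probability.LatticeModels.box 2 7)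
    (gA : Fin nSA → β → α)
    (hgA : ∀ l b, d (gA l b) = Orb.embMap (PolySite.incl (hshA l)) (Orb.embMap (PolySite.d4Emb (γA l) (wvA l) Λ) (dΛ b)))
    (SYA : Fin nSA → Terms β) (CWA : Terms α) (hcwA : ∀ wc ∈ CWA, chargeW wc.1 ≠ 0 ∨ spinChargeW sp wc.1 ≠ 0) (AVA : List (Terms α))
    {RA : CARPoly.Poly α}
    (hRA : evalPoly d RA = termOp d (residTG TXA μA νA o κA capA κA' flA TEA TGA THA f EB gA SYA CWA AVA))
    {βA : ℚ} (hβA : βA ≤ lowerConst RA + (μA 0 + μA 1) * (n₀ / 2 - νA)) {slA : ℚ} (hslA : slA = (μA 0 + μA 1) / 2)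
    -- vertex B
    (THB : Terms α) (hHB : termOp d THB = (hubbardTTPrimeFermionInteraction 1 (sB : ℝ) (U : ℝ)).localHamiltonian (Literature.Probability.LatticeModels.box 2 7))
    (TEB : Terms α)
    (hEB : termOp d TEB = fermionEmbed (PolySite.incl h0) ((hubbardTTPrimeFermionInteraction 1 (sB : ℝ) (U : ℝ)).meanEnergyObs 1))
    (TXB : Terms α) (hXB : termOp d TXB = X (sB : ℝ)) (μB : Fin 2 → ℚ) (νB κB capB κB' flB : ℚ)
    (TGB : Terms α) {mB : Type*} [Fintype mB] [DecidableEq mB] {ΛmB : Matrix mB mB ℂ} (hΛmB : ΛmB.PosSemidef)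
    (OB : mB → FermionOp (Literature.Probability.LatticeModels.box 2 7)) (hGB : termOp d TGB = gramForm ΛmB OB)
    {nSB : ℕ} (γB : Fin nSB → DihedralGroup 4) (wvB : Fin nSB → Site 2) (hshB : ∀ l, d4ShiftSet (γB l) (wvB l) Λ ⊆ Literature.Probability.LatticeModels.box 2 7)
    (gB : Fin nSB → β → α)
    (hgB : ∀ l b, d (gB l b) = Orb.embMap (PolySite.incl (hshB l)) (Orb.embMap (PolySite.d4Emb (γB l) (wvB l) Λ) (dΛ b)))
    (SYB : Fin nSB → Terms β) (CWB : Terms α) (hcwB : ∀ wc ∈ CWB, chargeW wc.1 ≠ 0 ∨ spinChargeW sp wc.1 ≠ 0) (AVB : List (Terms α))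
    {RB : CARPoly.Poly α}
    (hRB : evalPoly d RB = termOp d (residTG TXB μB νB o κB capB κB' flB TEB TGB THB f EB gB SYB CWB AVB))
    {βB : ℚ} (hβB : βB ≤ lowerConst RB + (μB 0 + μB 1) * (n₀ / 2 - νB)) {slB : ℚ} (hslB : slB = (μB 0 + μB 1) / 2) :
    TPrimePinnedPairFamilyRowWN (U : ℝ) (sA : ℝ) (sB : ℝ) capA capB flA flB βA κA κA' slA βB κB κB' slB n₀ X := by
  have hUr : (0 : ℝ) ≤ ((U : ℚ) : ℝ) := by exact_mod_cast hU
  -- (1) the two window identities from the SEMANTIC residual hypotheses, on the objectives `X sA`, `X sB`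
  have hcertA := windowIdentity_of_residPoly hΛ hz d dΛ f hf THA _ hHA TEA _ hEA o ho TXA μA νA κA capA κA' flA TGA ΛmA OA hGA EB
    γA wvA hshA gA hgA SYA CWA AVA hRA
  rw [hXA] at hcertA
  have hcertB := windowIdentity_of_residPoly hΛ hz d dΛ f hf THB _ hHB TEB _ hEB o ho TXB μB νB κB capB κB' flB TGB ΛmB OB hGB EB
    γB wvB hshB gB hgB SYB CWB AVB hRB
  rw [hXB] at hcertB
  -- (2) the charged words are charged (decided on the syntax)
  have hcwA' := charged_of_hcw d sp hsp CWA hcwA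
  have hcwB' := charged_of_hcw d sp hsp CWB hcwB
  -- (3) the prices are `lowerConst R_v` (valid for ANY polynomial denoting the residual); the filling slopes are half the density multipliers
  have hβA' : ((βA : ℚ) : ℝ) ≤ ((constCoeff RA : ℚ) : ℝ) - ∑ k ∈ (Finset.univ : Finset (Fin RA.length)), ‖resCoeff RA k‖ +
      (∑ σ : Fin 2, ((μA σ : ℚ) : ℝ)) * (((n₀ : ℚ) : ℝ) / 2 - ((νA : ℚ) : ℝ)) := by
    rw [constCoeff_sub_sum_norm_resCoeff RA, Fin.sum_univ_two]
    have h2 : ((βA : ℚ) : ℝ) ≤ (((lowerConst RA + (μA 0 + μA 1) * (n₀ / 2 - νA) : ℚ)) : ℝ) := by exact_mod_cast hβA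
    push_cast at h2
    linarith
  have hβB' : ((βB : ℚ) : ℝ) ≤ ((constCoeff RB : ℚ) : ℝ) - ∑ k ∈ (Finset.univ : Finset (Fin RB.length)), ‖resCoeff RB k‖ +
      (∑ σ : Fin 2, ((μB σ : ℚ) : ℝ)) * (((n₀ : ℚ) : ℝ) / 2 - ((νB : ℚ) : ℝ)) := by
    rw [constCoeff_sub_sum_norm_resCoeff RB, Fin.sum_univ_two]
    have h2 : ((βB : ℚ) : ℝ) ≤ (((lowerConst RB + (μB 0 + μB 1) * (n₀ / 2 - νB) : ℚ)) : ℝ) := by exact_mod_cast hβB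
    push_cast at h2
    linarith
  have hslA' : ((slA : ℚ) : ℝ) = (∑ σ : Fin 2, ((μA σ : ℚ) : ℝ)) / 2 := by
    rw [Fin.sum_univ_two, hslA]; push_cast; ring
  have hslB' : ((slB : ℚ) : ℝ) = (∑ σ : Fin 2, ((μB σ : ℚ) : ℝ)) / 2 := by
    rw [Fin.sum_univ_two, hslB]; push_cast; ring
  -- (4) the identity-level pair theorem (density-affine family edition), with the SHARED eom words `B_k := termOp dΛ (EB.get k)`
  exact TPrimePinnedPairFamilyRowWN.of_window_certificates hUr X hΛ h8 h0 hz
    (Finset.univ : Finset (Fin EB.length)) (fun k => termOp dΛ (EB.get k))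
    (fun σ => ((μA σ : ℚ) : ℝ)) ((νA : ℚ) : ℝ) hΛmA OA Finset.univ γA wvA hshA (fun l => termOp dΛ (SYA l))
    Finset.univ (fun j => (((CWA.get j).2 : ℚ) : ℂ)) (fun j => wmap d (CWA.get j).1) hcwA' Finset.univ (fun _ => (1 : ℝ))
    (fun m' => termOp d (AVA.get m')) Finset.univ (resCoeff RA) (resWord d RA) hcertA hβA' hslA'
    (fun σ => ((μB σ : ℚ) : ℝ)) ((νB : ℚ) : ℝ) hΛmB OB Finset.univ γB wvB hshB (fun l => termOp dΛ (SYB l))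
    Finset.univ (fun j => (((CWB.get j).2 : ℚ) : ℂ)) (fun j => wmap d (CWB.get j).1) hcwB' Finset.univ (fun _ => (1 : ℝ))
    (fun m' => termOp d (AVB.get m')) Finset.univ (resCoeff RB) (resWord d RB) hcertB hβB' hslB'

/-- **CONSTANT-OBJECTIVE WN PAIR NODE‴ FROM TWO RESIDUALS DENOTED BY ANY POLYNOMIALS** (`TPrimePinnedPairRowWN … X₀`; both certificates bound the SAME word
`X₀`), via `TPrimePinnedPairRowWN_iff_family`. [cite: WangEtAl2024, §III] [cite: JanssonChaykinKeil2008, §3] -/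
theorem TPrimePinnedPairRowWN.of_residPolys
    (U : ℚ) (hU : 0 ≤ U) (n₀ sA sB : ℚ)
    {Λ : Finset (Site 2)} (hΛ : Λ ⊆ Literature.Probability.LatticeModels.box 2 7) (h8 : thicken Λ 1 ⊆ Literature.Probability.LatticeModels.box 2 7)
    (h0 : thicken ({0} : Finset (Site 2)) 1 ⊆ Literature.Probability.LatticeModels.box 2 7) (hz : (0 : Site 2) ∈ Literature.Probability.LatticeModels.box 2 7)
    (d : α → Orb (PolySite (Literature.Probability.LatticeModels.box 2 7)))
    (dΛ : β → Orb (PolySite Λ)) (f : β → α) (hf : ∀ b, d (f b) = Orb.embMap (PolySite.incl hΛ) (dΛ b))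
    (sp : α → Fin 2) (hsp : ∀ a, (ofLex (d a)).2 = sp a)
    (o : Fin 2 → α) (ho : ∀ σ, d (o σ) = orb (PolySite.pt 0 hz) σ)
    (X₀ : FermionOp (Literature.Probability.LatticeModels.box 2 7)) (EB : List (Terms β))
    -- vertex A
    (THA : Terms α) (hHA : termOp d THA = (hubbardTTPrimeFermionInteraction 1 (sA : ℝ) (U : ℝ)).localHamiltonian (Literature.Probability.LatticeModels.box 2 7))
    (TEA : Terms α)
    (hEA : termOp d TEA = fermionEmbed (PolySite.incl h0) ((hubbardTTPrimeFermionInteraction 1 (sA : ℝ) (U : ℝ)).meanEnergyObs 1))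
    (TXA : Terms α) (hXA : termOp d TXA = X₀) (μA : Fin 2 → ℚ) (νA κA capA κA' flA : ℚ)
    (TGA : Terms α) {mA : Type*} [Fintype mA] [DecidableEq mA] {ΛmA : Matrix mA mA ℂ} (hΛmA : ΛmA.PosSemidef)
    (OA : mA → FermionOp (Literature.Probability.LatticeModels.box 2 7)) (hGA : termOp d TGA = gramForm ΛmA OA)
    {nSA : ℕ} (γA : Fin nSA → DihedralGroup 4) (wvA : Fin nSA → Site 2) (hshA : ∀ l, d4ShiftSet (γA l) (wvA l) Λ ⊆ Literature.Probability.LatticeModels.box 2 7)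
    (gA : Fin nSA → β → α)
    (hgA : ∀ l b, d (gA l b) = Orb.embMap (PolySite.incl (hshA l)) (Orb.embMap (PolySite.d4Emb (γA l) (wvA l) Λ) (dΛ b)))
    (SYA : Fin nSA → Terms β) (CWA : Terms α) (hcwA : ∀ wc ∈ CWA, chargeW wc.1 ≠ 0 ∨ spinChargeW sp wc.1 ≠ 0) (AVA : List (Terms α))
    {RA : CARPoly.Poly α}
    (hRA : evalPoly d RA = termOp d (residTG TXA μA νA o κA capA κA' flA TEA TGA THA f EB gA SYA CWA AVA))
    {βA : ℚ} (hβA : βA ≤ lowerConst RA + (μA 0 + μA 1) * (n₀ / 2 - νA)) {slA : ℚ} (hslA : slA = (μA 0 + μA 1) / 2)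
    -- vertex B
    (THB : Terms α) (hHB : termOp d THB = (hubbardTTPrimeFermionInteraction 1 (sB : ℝ) (U : ℝ)).localHamiltonian (Literature.Probability.LatticeModels.box 2 7))
    (TEB : Terms α)
    (hEB : termOp d TEB = fermionEmbed (PolySite.incl h0) ((hubbardTTPrimeFermionInteraction 1 (sB : ℝ) (U : ℝ)).meanEnergyObs 1))
    (TXB : Terms α) (hXB : termOp d TXB = X₀) (μB : Fin 2 → ℚ) (νB κB capB κB' flB : ℚ)
    (TGB : Terms α) {mB : Type*} [Fintype mB] [DecidableEq mB] {ΛmB : Matrix mB mB ℂ} (hΛmB : ΛmB.PosSemidef)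
    (OB : mB → FermionOp (Literature.Probability.LatticeModels.box 2 7)) (hGB : termOp d TGB = gramForm ΛmB OB)
    {nSB : ℕ} (γB : Fin nSB → DihedralGroup 4) (wvB : Fin nSB → Site 2) (hshB : ∀ l, d4ShiftSet (γB l) (wvB l) Λ ⊆ Literature.Probability.LatticeModels.box 2 7)
    (gB : Fin nSB → β → α)
    (hgB : ∀ l b, d (gB l b) = Orb.embMap (PolySite.incl (hshB l)) (Orb.embMap (PolySite.d4Emb (γB l) (wvB l) Λ) (dΛ b)))
    (SYB : Fin nSB → Terms β) (CWB : Terms α) (hcwB : ∀ wc ∈ CWB, chargeW wc.1 ≠ 0 ∨ spinChargeW sp wc.1 ≠ 0) (AVB : List (Terms α))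
    {RB : CARPoly.Poly α}
    (hRB : evalPoly d RB = termOp d (residTG TXB μB νB o κB capB κB' flB TEB TGB THB f EB gB SYB CWB AVB))
    {βB : ℚ} (hβB : βB ≤ lowerConst RB + (μB 0 + μB 1) * (n₀ / 2 - νB)) {slB : ℚ} (hslB : slB = (μB 0 + μB 1) / 2) :
    TPrimePinnedPairRowWN (U : ℝ) (sA : ℝ) (sB : ℝ) capA capB flA flB βA κA κA' slA βB κB κB' slB n₀ X₀ :=
  (TPrimePinnedPairRowWN_iff_family).2
    (TPrimePinnedPairFamilyRowWN.of_residPolys U hU n₀ sA sB hΛ h8 h0 hz d dΛ f hf sp hsp o ho (fun _ => X₀) EB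
      THA hHA TEA hEA TXA hXA μA νA κA capA κA' flA TGA hΛmA OA hGA γA wvA hshA gA hgA SYA CWA hcwA AVA hRA hβA hslA
      THB hHB TEB hEB TXB hXB μB νB κB capB κB' flB TGB hΛmB OB hGB γB wvB hshB gB hgB SYB CWB hcwB AVB hRB hβB hslB)

end ResidPolyPair

/-! ## §2 The two-level (symmetry-adapted, thin-integer) Gram instances — the Gram shape the staged chain is sliced over -/

section ResidPolyPairTB

variable {α β : Type*}

/-- **WN-FAMILY PAIR NODE‴ FROM TWO SEMANTIC RESIDUALS, TWO-LEVEL GRAM** (`TG_v := gramTB K_v blocks_v`, PSD by construction — no positivity obligation).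
[cite: WangEtAl2024, §III] [cite: Han2020Bootstrap, §2] [cite: JanssonChaykinKeil2008, §3] -/
theorem TPrimePinnedPairFamilyRowWN.of_residPolys_tb
    (U : ℚ) (hU : 0 ≤ U) (n₀ sA sB : ℚ)
    {Λ : Finset (Site 2)} (hΛ : Λ ⊆ Literature.Probability.LatticeModels.box 2 7) (h8 : thicken Λ 1 ⊆ Literature.Probability.LatticeModels.box 2 7)
    (h0 : thicken ({0} : Finset (Site 2)) 1 ⊆ Literature.Probability.LatticeModels.box 2 7) (hz : (0 : Site 2) ∈ Literature.Probability.LatticeModels.box 2 7)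
    (d : α → Orb (PolySite (Literature.Probability.LatticeModels.box 2 7)))
    (dΛ : β → Orb (PolySite Λ)) (f : β → α) (hf : ∀ b, d (f b) = Orb.embMap (PolySite.incl hΛ) (dΛ b))
    (sp : α → Fin 2) (hsp : ∀ a, (ofLex (d a)).2 = sp a)
    (o : Fin 2 → α) (ho : ∀ σ, d (o σ) = orb (PolySite.pt 0 hz) σ)
    (X : ℝ → FermionOp (Literature.Probability.LatticeModels.box 2 7)) (EB : List (Terms β))
    -- vertex A
    (THA : Terms α) (hHA : termOp d THA = (hubbardTTPrimeFermionInteraction 1 (sA : ℝ) (U : ℝ)).localHamiltonian (Literature.Probability.LatticeModels.box 2 7))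
    (TEA : Terms α)
    (hEA : termOp d TEA = fermionEmbed (PolySite.incl h0) ((hubbardTTPrimeFermionInteraction 1 (sA : ℝ) (U : ℝ)).meanEnergyObs 1))
    (TXA : Terms α) (hXA : termOp d TXA = X (sA : ℝ)) (μA : Fin 2 → ℚ) (νA κA capA κA' flA : ℚ)
    (KA : ℕ) (blocksA : List (List (List ℤ × Terms α)))
    {nSA : ℕ} (γA : Fin nSA → DihedralGroup 4) (wvA : Fin nSA → Site 2) (hshA : ∀ l, d4ShiftSet (γA l) (wvA l) Λ ⊆ Literature.Probability.LatticeModels.box 2 7)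
    (gA : Fin nSA → β → α)
    (hgA : ∀ l b, d (gA l b) = Orb.embMap (PolySite.incl (hshA l)) (Orb.embMap (PolySite.d4Emb (γA l) (wvA l) Λ) (dΛ b)))
    (SYA : Fin nSA → Terms β) (CWA : Terms α) (hcwA : ∀ wc ∈ CWA, chargeW wc.1 ≠ 0 ∨ spinChargeW sp wc.1 ≠ 0) (AVA : List (Terms α))
    {RA : CARPoly.Poly α}
    (hRA : evalPoly d RA = termOp d (residTG TXA μA νA o κA capA κA' flA TEA (gramTB KA blocksA) THA f EB gA SYA CWA AVA))
    {βA : ℚ} (hβA : βA ≤ lowerConst RA + (μA 0 + μA 1) * (n₀ / 2 - νA)) {slA : ℚ} (hslA : slA = (μA 0 + μA 1) / 2)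
    -- vertex B
    (THB : Terms α) (hHB : termOp d THB = (hubbardTTPrimeFermionInteraction 1 (sB : ℝ) (U : ℝ)).localHamiltonian (Literature.Probability.LatticeModels.box 2 7))
    (TEB : Terms α)
    (hEB : termOp d TEB = fermionEmbed (PolySite.incl h0) ((hubbardTTPrimeFermionInteraction 1 (sB : ℝ) (U : ℝ)).meanEnergyObs 1))
    (TXB : Terms α) (hXB : termOp d TXB = X (sB : ℝ)) (μB : Fin 2 → ℚ) (νB κB capB κB' flB : ℚ)
    (KB : ℕ) (blocksB : List (List (List ℤ × Terms α)))
    {nSB : ℕ} (γB : Fin nSB → DihedralGroup 4) (wvB : Fin nSB → Site 2) (hshB : ∀ l, d4ShiftSet (γB l) (wvB l) Λ ⊆ Literature.Probability.LatticeModels.box 2 7)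
    (gB : Fin nSB → β → α)
    (hgB : ∀ l b, d (gB l b) = Orb.embMap (PolySite.incl (hshB l)) (Orb.embMap (PolySite.d4Emb (γB l) (wvB l) Λ) (dΛ b)))
    (SYB : Fin nSB → Terms β) (CWB : Terms α) (hcwB : ∀ wc ∈ CWB, chargeW wc.1 ≠ 0 ∨ spinChargeW sp wc.1 ≠ 0) (AVB : List (Terms α))
    {RB : CARPoly.Poly α}
    (hRB : evalPoly d RB = termOp d (residTG TXB μB νB o κB capB κB' flB TEB (gramTB KB blocksB) THB f EB gB SYB CWB AVB))
    {βB : ℚ} (hβB : βB ≤ lowerConst RB + (μB 0 + μB 1) * (n₀ / 2 - νB)) {slB : ℚ} (hslB : slB = (μB 0 + μB 1) / 2) :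
    TPrimePinnedPairFamilyRowWN (U : ℝ) (sA : ℝ) (sB : ℝ) capA capB flA flB βA κA κA' slA βB κB κB' slB n₀ X :=
  TPrimePinnedPairFamilyRowWN.of_residPolys U hU n₀ sA sB hΛ h8 h0 hz d dΛ f hf sp hsp o ho X EB
    THA hHA TEA hEA TXA hXA μA νA κA capA κA' flA (gramTB KA blocksA) (gramTBCoef_posSemidef KA blocksA) (gramTBOp d blocksA)
    (termOp_gramTB_eq_gramForm d KA blocksA) γA wvA hshA gA hgA SYA CWA hcwA AVA hRA hβA hslA
    THB hHB TEB hEB TXB hXB μB νB κB capB κB' flB (gramTB KB blocksB) (gramTBCoef_posSemidef KB blocksB) (gramTBOp d blocksB)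
    (termOp_gramTB_eq_gramForm d KB blocksB) γB wvB hshB gB hgB SYB CWB hcwB AVB hRB hβB hslB

/-- **CONSTANT-OBJECTIVE WN PAIR NODE‴ FROM TWO SEMANTIC RESIDUALS, TWO-LEVEL GRAM.** [cite: WangEtAl2024, §III] [cite: Han2020Bootstrap, §2] -/
theorem TPrimePinnedPairRowWN.of_residPolys_tb
    (U : ℚ) (hU : 0 ≤ U) (n₀ sA sB : ℚ)
    {Λ : Finset (Site 2)} (hΛ : Λ ⊆ Literature.Probability.LatticeModels.box 2 7) (h8 : thicken Λ 1 ⊆ Literature.Probability.LatticeModels.box 2 7)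
    (h0 : thicken ({0} : Finset (Site 2)) 1 ⊆ Literature.Probability.LatticeModels.box 2 7) (hz : (0 : Site 2) ∈ Literature.Probability.LatticeModels.box 2 7)
    (d : α → Orb (PolySite (Literature.Probability.LatticeModels.box 2 7)))
    (dΛ : β → Orb (PolySite Λ)) (f : β → α) (hf : ∀ b, d (f b) = Orb.embMap (PolySite.incl hΛ) (dΛ b))
    (sp : α → Fin 2) (hsp : ∀ a, (ofLex (d a)).2 = sp a)
    (o : Fin 2 → α) (ho : ∀ σ, d (o σ) = orb (PolySite.pt 0 hz) σ)
    (X₀ : FermionOp (Literature.Probability.LatticeModels.box 2 7)) (EB : List (Terms β))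
    -- vertex A
    (THA : Terms α) (hHA : termOp d THA = (hubbardTTPrimeFermionInteraction 1 (sA : ℝ) (U : ℝ)).localHamiltonian (Literature.Probability.LatticeModels.box 2 7))
    (TEA : Terms α)
    (hEA : termOp d TEA = fermionEmbed (PolySite.incl h0) ((hubbardTTPrimeFermionInteraction 1 (sA : ℝ) (U : ℝ)).meanEnergyObs 1))
    (TXA : Terms α) (hXA : termOp d TXA = X₀) (μA : Fin 2 → ℚ) (νA κA capA κA' flA : ℚ)
    (KA : ℕ) (blocksA : List (List (List ℤ × Terms α)))
    {nSA : ℕ} (γA : Fin nSA → DihedralGroup 4) (wvA : Fin nSA → Site 2) (hshA : ∀ l, d4ShiftSet (γA l) (wvA l) Λ ⊆ Literature.Probability.LatticeModels.box 2 7)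
    (gA : Fin nSA → β → α)
    (hgA : ∀ l b, d (gA l b) = Orb.embMap (PolySite.incl (hshA l)) (Orb.embMap (PolySite.d4Emb (γA l) (wvA l) Λ) (dΛ b)))
    (SYA : Fin nSA → Terms β) (CWA : Terms α) (hcwA : ∀ wc ∈ CWA, chargeW wc.1 ≠ 0 ∨ spinChargeW sp wc.1 ≠ 0) (AVA : List (Terms α))
    {RA : CARPoly.Poly α}
    (hRA : evalPoly d RA = termOp d (residTG TXA μA νA o κA capA κA' flA TEA (gramTB KA blocksA) THA f EB gA SYA CWA AVA))
    {βA : ℚ} (hβA : βA ≤ lowerConst RA + (μA 0 + μA 1) * (n₀ / 2 - νA)) {slA : ℚ} (hslA : slA = (μA 0 + μA 1) / 2)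
    -- vertex B
    (THB : Terms α) (hHB : termOp d THB = (hubbardTTPrimeFermionInteraction 1 (sB : ℝ) (U : ℝ)).localHamiltonian (Literature.Probability.LatticeModels.box 2 7))
    (TEB : Terms α)
    (hEB : termOp d TEB = fermionEmbed (PolySite.incl h0) ((hubbardTTPrimeFermionInteraction 1 (sB : ℝ) (U : ℝ)).meanEnergyObs 1))
    (TXB : Terms α) (hXB : termOp d TXB = X₀) (μB : Fin 2 → ℚ) (νB κB capB κB' flB : ℚ)
    (KB : ℕ) (blocksB : List (List (List ℤ × Terms α)))
    {nSB : ℕ} (γB : Fin nSB → DihedralGroup 4) (wvB : Fin nSB → Site 2) (hshB : ∀ l, d4ShiftSet (γB l) (wvB l) Λ ⊆ Literature.Probability.LatticeModels.box 2 7)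
    (gB : Fin nSB → β → α)
    (hgB : ∀ l b, d (gB l b) = Orb.embMap (PolySite.incl (hshB l)) (Orb.embMap (PolySite.d4Emb (γB l) (wvB l) Λ) (dΛ b)))
    (SYB : Fin nSB → Terms β) (CWB : Terms α) (hcwB : ∀ wc ∈ CWB, chargeW wc.1 ≠ 0 ∨ spinChargeW sp wc.1 ≠ 0) (AVB : List (Terms α))
    {RB : CARPoly.Poly α}
    (hRB : evalPoly d RB = termOp d (residTG TXB μB νB o κB capB κB' flB TEB (gramTB KB blocksB) THB f EB gB SYB CWB AVB))
    {βB : ℚ} (hβB : βB ≤ lowerConst RB + (μB 0 + μB 1) * (n₀ / 2 - νB)) {slB : ℚ} (hslB : slB = (μB 0 + μB 1) / 2) :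
    TPrimePinnedPairRowWN (U : ℝ) (sA : ℝ) (sB : ℝ) capA capB flA flB βA κA κA' slA βB κB κB' slB n₀ X₀ :=
  (TPrimePinnedPairRowWN_iff_family).2
    (TPrimePinnedPairFamilyRowWN.of_residPolys_tb U hU n₀ sA sB hΛ h8 h0 hz d dΛ f hf sp hsp o ho (fun _ => X₀) EB
      THA hHA TEA hEA TXA hXA μA νA κA capA κA' flA KA blocksA γA wvA hshA gA hgA SYA CWA hcwA AVA hRA hβA hslA
      THB hHB TEB hEB TXB hXB μB νB κB capB κB' flB KB blocksB γB wvB hshB gB hgB SYB CWB hcwB AVB hRB hβB hslB)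

end ResidPolyPairTB

/-! ## §3 The one-shot abstract-Gram instance for the constant shape (the family one-shot edition is p669208's `…of_kernelCerts`) -/

section KernelPairG

variable {α β : Type*} [LinearOrder α]

/-- **KERNEL FORM OF THE CONSTANT-OBJECTIVE WN PAIR NODE‴, ABSTRACT GRAM SLOTS, ONE-SHOT NORMAL FORM** (`normalize enc Bkey (residTG …_v) = R_v`; via
`evalPoly_normalize'` an instance of `…of_residPolys`). [cite: WangEtAl2024, §III] [cite: JanssonChaykinKeil2008, §3] -/
theorem TPrimePinnedPairRowWN.of_kernelCerts
    (U : ℚ) (hU : 0 ≤ U) (n₀ sA sB : ℚ)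
    {Λ : Finset (Site 2)} (hΛ : Λ ⊆ Literature.Probability.LatticeModels.box 2 7) (h8 : thicken Λ 1 ⊆ Literature.Probability.LatticeModels.box 2 7)
    (h0 : thicken ({0} : Finset (Site 2)) 1 ⊆ Literature.Probability.LatticeModels.box 2 7) (hz : (0 : Site 2) ∈ Literature.Probability.LatticeModels.box 2 7)
    (d : α → Orb (PolySite (Literature.Probability.LatticeModels.box 2 7))) (hd : Function.Injective d) (enc : α → ℕ) (Bkey : ℕ)
    (dΛ : β → Orb (PolySite Λ)) (f : β → α) (hf : ∀ b, d (f b) = Orb.embMap (PolySite.incl hΛ) (dΛ b))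
    (sp : α → Fin 2) (hsp : ∀ a, (ofLex (d a)).2 = sp a)
    (o : Fin 2 → α) (ho : ∀ σ, d (o σ) = orb (PolySite.pt 0 hz) σ)
    (X₀ : FermionOp (Literature.Probability.LatticeModels.box 2 7)) (EB : List (Terms β))
    -- vertex A
    (THA : Terms α) (hHA : termOp d THA = (hubbardTTPrimeFermionInteraction 1 (sA : ℝ) (U : ℝ)).localHamiltonian (Literature.Probability.LatticeModels.box 2 7))
    (TEA : Terms α)
    (hEA : termOp d TEA = fermionEmbed (PolySite.incl h0) ((hubbardTTPrimeFermionInteraction 1 (sA : ℝ) (U : ℝ)).meanEnergyObs 1))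
    (TXA : Terms α) (hXA : termOp d TXA = X₀) (μA : Fin 2 → ℚ) (νA κA capA κA' flA : ℚ)
    (TGA : Terms α) {mA : Type*} [Fintype mA] [DecidableEq mA] {ΛmA : Matrix mA mA ℂ} (hΛmA : ΛmA.PosSemidef)
    (OA : mA → FermionOp (Literature.Probability.LatticeModels.box 2 7)) (hGA : termOp d TGA = gramForm ΛmA OA)
    {nSA : ℕ} (γA : Fin nSA → DihedralGroup 4) (wvA : Fin nSA → Site 2) (hshA : ∀ l, d4ShiftSet (γA l) (wvA l) Λ ⊆ Literature.Probability.LatticeModels.box 2 7)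
    (gA : Fin nSA → β → α)
    (hgA : ∀ l b, d (gA l b) = Orb.embMap (PolySite.incl (hshA l)) (Orb.embMap (PolySite.d4Emb (γA l) (wvA l) Λ) (dΛ b)))
    (SYA : Fin nSA → Terms β) (CWA : Terms α) (hcwA : ∀ wc ∈ CWA, chargeW wc.1 ≠ 0 ∨ spinChargeW sp wc.1 ≠ 0) (AVA : List (Terms α))
    {RA : CARPoly.Poly α}
    (hRA : CARPoly.normalize enc Bkey (residTG TXA μA νA o κA capA κA' flA TEA TGA THA f EB gA SYA CWA AVA) = RA)
    {βA : ℚ} (hβA : βA ≤ lowerConst RA + (μA 0 + μA 1) * (n₀ / 2 - νA)) {slA : ℚ} (hslA : slA = (μA 0 + μA 1) / 2)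
    -- vertex B
    (THB : Terms α) (hHB : termOp d THB = (hubbardTTPrimeFermionInteraction 1 (sB : ℝ) (U : ℝ)).localHamiltonian (Literature.Probability.LatticeModels.box 2 7))
    (TEB : Terms α)
    (hEB : termOp d TEB = fermionEmbed (PolySite.incl h0) ((hubbardTTPrimeFermionInteraction 1 (sB : ℝ) (U : ℝ)).meanEnergyObs 1))
    (TXB : Terms α) (hXB : termOp d TXB = X₀) (μB : Fin 2 → ℚ) (νB κB capB κB' flB : ℚ)
    (TGB : Terms α) {mB : Type*} [Fintype mB] [DecidableEq mB] {ΛmB : Matrix mB mB ℂ} (hΛmB : ΛmB.PosSemidef)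
    (OB : mB → FermionOp (Literature.Probability.LatticeModels.box 2 7)) (hGB : termOp d TGB = gramForm ΛmB OB)
    {nSB : ℕ} (γB : Fin nSB → DihedralGroup 4) (wvB : Fin nSB → Site 2) (hshB : ∀ l, d4ShiftSet (γB l) (wvB l) Λ ⊆ Literature.Probability.LatticeModels.box 2 7)
    (gB : Fin nSB → β → α)
    (hgB : ∀ l b, d (gB l b) = Orb.embMap (PolySite.incl (hshB l)) (Orb.embMap (PolySite.d4Emb (γB l) (wvB l) Λ) (dΛ b)))
    (SYB : Fin nSB → Terms β) (CWB : Terms α) (hcwB : ∀ wc ∈ CWB, chargeW wc.1 ≠ 0 ∨ spinChargeW sp wc.1 ≠ 0) (AVB : List (Terms α))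
    {RB : CARPoly.Poly α}
    (hRB : CARPoly.normalize enc Bkey (residTG TXB μB νB o κB capB κB' flB TEB TGB THB f EB gB SYB CWB AVB) = RB)
    {βB : ℚ} (hβB : βB ≤ lowerConst RB + (μB 0 + μB 1) * (n₀ / 2 - νB)) {slB : ℚ} (hslB : slB = (μB 0 + μB 1) / 2) :
    TPrimePinnedPairRowWN (U : ℝ) (sA : ℝ) (sB : ℝ) capA capB flA flB βA κA κA' slA βB κB κB' slB n₀ X₀ :=
  TPrimePinnedPairRowWN.of_residPolys U hU n₀ sA sB hΛ h8 h0 hz d dΛ f hf sp hsp o ho X₀ EB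
    THA hHA TEA hEA TXA hXA μA νA κA capA κA' flA TGA hΛmA OA hGA γA wvA hshA gA hgA SYA CWA hcwA AVA
    (by rw [← hRA]; exact evalPoly_normalize' hd enc Bkey _) hβA hslA
    THB hHB TEB hEB TXB hXB μB νB κB capB κB' flB TGB hΛmB OB hGB γB wvB hshB gB hgB SYB CWB hcwB AVB
    (by rw [← hRB]; exact evalPoly_normalize' hd enc Bkey _) hβB hslB

end KernelPairG

end Summit.Ventures.CertifiedManyBodySolver.Downfold

end
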